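import Summits.NavierStokesRegularity.NavierStokesRegularity.Theorems.EfficiencyFloorRigidExitReferenceFlowWindow
import Literature.Analysis.FluidPDE.AxisymmetricVorticityTransport
import Literature.Analysis.FluidPDE.SerrinEnstrophyGronwall
import Literature.Analysis.FluidPDE.KNSSThm52Integrand
import HarnessLib

/-!
# Route `EfficiencyFloor`, support `RigidExit` (stmt-NavierStokesRegularity-25513) on the `ProductionEfficiencyDecay` ladder
# (stmt-NavierStokesRegularity-22866): TIME-CONTINUITY OF THE PALINSTROPHY in the Beale–Kato–Majda class

Helper file (`--supports stmt-NavierStokesRegularity-22866`; line `efficiency_floor`). Item 3 of the (R-shadow) census (uniformity of the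
Grönwall exponent `Λ = ∫ (2‖u‖²_∞/ν + 27A⁴Z²/(2ν³))` of the tree's `classicalNS_robustness_of_regularity_R3` over near-maximiser flows) needs the
PALINSTROPHY `Pal(t) = ∫|∇ curl u(t)|²_F` as a genuine function of time — continuous, hence integrable — along both the class flow and the
reference flow (to bound `∫‖u‖²_∞ ≤ A²∫√(Z·Pal)` via Agmon, and `ν∫Pal` by the enstrophy budget). The tree has time-continuity of the
ENSTROPHY in the BKM class (`BKMClassEnstrophyContinuity`) but not of the palinstrophy. This file supplies it, by applying the landed
generic balance `IsSmoothSpaceTimeOn.enstrophy_balance` (SerrinEnstrophyGronwall: continuity of `∫|∇w|²_F` for a jointly smooth `w` with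
`D¹w, D¹∂ₜw ∈ L^∞_t L²_x`) to the VORTICITY field `w = curl u`:

* `exists_lintegral_iteratedFDeriv_one_curl_le` — `∫⁻‖D¹(curl w)‖ₑ² ≤ K·∫⁻‖D²w‖ₑ²` (`K = ‖curl ∘‖²`);
* `continuousOn_palinstrophy` — for `u` jointly smooth on `[0,T] × ℝ³` with `D²u, D²∂ₜu ∈ L^∞_t L²_x` (e.g. `HasBoundedSobolevNormsOn`
  of `u` and `∂ₜu`, the BKM/Tao class): `t ↦ ∫|∇ curl u(t)|²_F` is continuous on `[0,T]`;
* `continuousOn_palinstrophy_of_hasBoundedSobolevNormsOn` — the same from `HasBoundedSobolevNormsOn (Icc 0 T) u` and `… (∂ₜu)`;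
* `ReferenceFlow.continuousOn_palinstrophy` — along the reference flow (Leray package: classical on `(0,T]`, Sobolev bounds of `v` and
  `∂ₜv` on every `[δ,T]`), the palinstrophy is continuous on every `[δ,T]`, `0 < δ < T` (time shift).

HONEST FRAMING: bookkeeping; (R-shadow), `RigidExit`, `NearMaximiserBoundedAmplification`, `LerayFloorGap`, `ProductionEfficiencyDecay`
(stmt-22866) and Navier–Stokes regularity stay OPEN; no summit statement is proved. [folklore]
-/

-- the problem directory repeats the summit name (`NavierStokesRegularity/NavierStokesRegularity`)
set_option linter.dupNamespace false

noncomputable section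

open Set Filter MeasureTheory Topology Function
open scoped InnerProductSpace RealInnerProductSpace ENNReal NNReal ContDiff
open Literature.Analysis.FluidPDE

namespace Summit.NavierStokesRegularity.NavierStokesRegularity.Theorems

namespace RigidExit

namespace ReferenceShadowing

section Palinstrophy

/-- `∫⁻‖D¹(curl w)‖ₑ² ≤ K·∫⁻‖D²w‖ₑ²` for one constant `K` (pointwise `‖D¹ curl w‖ ≤ ‖curl∘‖·‖D²w‖`, `norm_iteratedFDeriv_curl_le`).
[folklore] -/
theorem exists_lintegral_iteratedFDeriv_one_curl_le :
    ∃ K : ℝ≥0, ∀ w : EuclideanSpace ℝ (Fin 3) → EuclideanSpace ℝ (Fin 3), ContDiff ℝ 2 w →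
      ∫⁻ x, ‖iteratedFDeriv ℝ 1 (curl w) x‖ₑ ^ 2 ≤ (K : ℝ≥0∞) * ∫⁻ x, ‖iteratedFDeriv ℝ 2 w x‖ₑ ^ 2 := by
  set L : (EuclideanSpace ℝ (Fin 3) →L[ℝ] EuclideanSpace ℝ (Fin 3)) →L[ℝ] EuclideanSpace ℝ (Fin 3) := curlCLM with hL
  have hL0 : 0 ≤ ‖L‖ := norm_nonneg L
  refine ⟨(‖L‖ ^ 2).toNNReal, fun w hw => ?_⟩
  have hK : (((‖L‖ ^ 2).toNNReal : ℝ≥0) : ℝ≥0∞) = ENNReal.ofReal (‖L‖ ^ 2) := rfl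
  have hpt : ∀ x, ‖iteratedFDeriv ℝ 1 (curl w) x‖ₑ ^ 2 ≤ ENNReal.ofReal (‖L‖ ^ 2) * ‖iteratedFDeriv ℝ 2 w x‖ₑ ^ 2 := by
    intro x
    have h : ‖iteratedFDeriv ℝ 1 (curl w) x‖ ≤ ‖L‖ * ‖iteratedFDeriv ℝ 2 w x‖ :=
      norm_iteratedFDeriv_curl_le (n := 1) (by exact_mod_cast hw) x
    have h2 : ‖iteratedFDeriv ℝ 1 (curl w) x‖ ^ 2 ≤ ‖L‖ ^ 2 * ‖iteratedFDeriv ℝ 2 w x‖ ^ 2 := by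
      rw [← mul_pow]; exact pow_le_pow_left₀ (norm_nonneg _) h 2
    rw [← ofReal_norm, ← ofReal_norm, ← ENNReal.ofReal_pow (norm_nonneg _), ← ENNReal.ofReal_pow (norm_nonneg _),
      ← ENNReal.ofReal_mul (sq_nonneg _)]
    exact ENNReal.ofReal_le_ofReal h2
  rw [hK]
  calc ∫⁻ x, ‖iteratedFDeriv ℝ 1 (curl w) x‖ₑ ^ 2 ≤ ∫⁻ x, ENNReal.ofReal (‖L‖ ^ 2) * ‖iteratedFDeriv ℝ 2 w x‖ₑ ^ 2 :=
        lintegral_mono hpt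
    _ = ENNReal.ofReal (‖L‖ ^ 2) * ∫⁻ x, ‖iteratedFDeriv ℝ 2 w x‖ₑ ^ 2 := lintegral_const_mul' _ _ ENNReal.ofReal_ne_top

/-- **Time-continuity of the palinstrophy** for a jointly smooth field `u` on `[0,T] × ℝ³` with `D²u` and `D²∂ₜu` bounded in `L²`
uniformly in time (`∂ₜ = timeDerivWithin (Icc 0 T)`): `t ↦ ∫|∇ curl u(t)|²_F` is continuous on `[0,T]`. [folklore] -/
theorem continuousOn_palinstrophy {T : ℝ} (hT : 0 < T) {u : ℝ → EuclideanSpace ℝ (Fin 3) → EuclideanSpace ℝ (Fin 3)}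
    (hu : IsSmoothSpaceTimeOn (Icc 0 T) u) {C₂ D₂ : ℝ≥0}
    (hC : ∀ t ∈ Icc 0 T, ∫⁻ x, ‖iteratedFDeriv ℝ 2 (u t) x‖ₑ ^ 2 ≤ C₂)
    (hD : ∀ t ∈ Icc 0 T, ∫⁻ x, ‖iteratedFDeriv ℝ 2 (timeDerivWithin (Icc 0 T) u t) x‖ₑ ^ 2 ≤ D₂) :
    ContinuousOn (fun t => ∫ x, frobeniusNormSq (fderiv ℝ (curl (u t)) x)) (Icc 0 T) := by
  have hU : UniqueDiffOn ℝ (Icc 0 T) := uniqueDiffOn_Icc hT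
  have hcl : Icc 0 T ⊆ closure (interior (Icc 0 T)) := by
    rw [interior_Icc, closure_Ioo hT.ne]
  obtain ⟨K₀, hK₀⟩ := exists_lintegral_iteratedFDeriv_one_curl_le
  -- the vorticity is jointly smooth
  have hω : IsSmoothSpaceTimeOn (Icc 0 T) (vorticity u) := hu.isSmoothSpaceTimeOn_vorticity hU
  -- `D¹ω ∈ L^∞_t L²_x`
  have h1 : ∀ t ∈ Icc 0 T, ∫⁻ x, ‖iteratedFDeriv ℝ 1 (vorticity u t) x‖ₑ ^ 2 ≤ ((K₀ * C₂ : ℝ≥0) : ℝ≥0∞) := by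
    intro t ht
    have hsm : ContDiff ℝ 2 (u t) := (hu.contDiff_slice ht).of_le (by norm_cast)
    calc ∫⁻ x, ‖iteratedFDeriv ℝ 1 (vorticity u t) x‖ₑ ^ 2 = ∫⁻ x, ‖iteratedFDeriv ℝ 1 (curl (u t)) x‖ₑ ^ 2 := rfl
      _ ≤ (K₀ : ℝ≥0∞) * ∫⁻ x, ‖iteratedFDeriv ℝ 2 (u t) x‖ₑ ^ 2 := hK₀ (u t) hsm
      _ ≤ (K₀ : ℝ≥0∞) * C₂ := mul_le_mul_right (hC t ht) _
      _ = ((K₀ * C₂ : ℝ≥0) : ℝ≥0∞) := by push_cast; ring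
  -- `D¹∂ₜω ∈ L^∞_t L²_x`: `∂ₜω = curl ∂ₜu`
  have h2 : ∀ t ∈ Icc 0 T, ∫⁻ x, ‖iteratedFDeriv ℝ 1 (timeDerivWithin (Icc 0 T) (vorticity u) t) x‖ₑ ^ 2 ≤
      ((K₀ * D₂ : ℝ≥0) : ℝ≥0∞) := by
    intro t ht
    have heq : timeDerivWithin (Icc 0 T) (vorticity u) t = curl (timeDerivWithin (Icc 0 T) u t) := by
      funext x
      exact (hu.curl_timeDerivWithin hU hcl ht x).symm
    have hsm : ContDiff ℝ 2 (timeDerivWithin (Icc 0 T) u t) := ((hu.timeDerivWithin hU).contDiff_slice ht).of_le (by norm_cast)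
    rw [heq]
    calc ∫⁻ x, ‖iteratedFDeriv ℝ 1 (curl (timeDerivWithin (Icc 0 T) u t)) x‖ₑ ^ 2
        ≤ (K₀ : ℝ≥0∞) * ∫⁻ x, ‖iteratedFDeriv ℝ 2 (timeDerivWithin (Icc 0 T) u t) x‖ₑ ^ 2 := hK₀ _ hsm
      _ ≤ (K₀ : ℝ≥0∞) * D₂ := mul_le_mul_right (hD t ht) _
      _ = ((K₀ * D₂ : ℝ≥0) : ℝ≥0∞) := by push_cast; ring
  -- the generic balance for the vorticity field
  exact (hω.enstrophy_balance hT h1 h2).2.1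

/-- **Time-continuity of the palinstrophy in the BKM class**: `HasBoundedSobolevNormsOn` of `u` and of `∂ₜu` on `[0,T]`. [folklore] -/
theorem continuousOn_palinstrophy_of_hasBoundedSobolevNormsOn {T : ℝ} (hT : 0 < T)
    {u : ℝ → EuclideanSpace ℝ (Fin 3) → EuclideanSpace ℝ (Fin 3)} (hu : IsSmoothSpaceTimeOn (Icc 0 T) u)
    (hB : HasBoundedSobolevNormsOn (Icc 0 T) u) (hBt : HasBoundedSobolevNormsOn (Icc 0 T) (timeDerivWithin (Icc 0 T) u)) :
    ContinuousOn (fun t => ∫ x, frobeniusNormSq (fderiv ℝ (curl (u t)) x)) (Icc 0 T) := by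
  obtain ⟨C₂, hC⟩ := hB 2
  obtain ⟨D₂, hD⟩ := hBt 2
  exact continuousOn_palinstrophy hT hu hC hD

end Palinstrophy

end ReferenceShadowing

namespace ReferenceFlow

/-- **Palinstrophy of the reference flow is continuous on every `[δ,T]`**, `0 < δ < T`: the Leray package (classical on `(0,T]`,
Sobolev bounds of `v` and `∂ₜv = timeDerivWithin (Ioc 0 T) v` on `[δ,T]`) after the time shift `s ↦ v (s + δ)`. [folklore] -/
theorem continuousOn_palinstrophy {ν T : ℝ} {v : ℝ → EuclideanSpace ℝ (Fin 3) → EuclideanSpace ℝ (Fin 3)}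
    {q : ℝ → EuclideanSpace ℝ (Fin 3) → ℝ} (hcl : IsClassicalNSSolutionOn (Ioc 0 T) ν 0 v q)
    (hB : ∀ δ : ℝ, 0 < δ → δ ≤ T → HasBoundedSobolevNormsOn (Icc δ T) v)
    (hBt : ∀ δ : ℝ, 0 < δ → δ ≤ T → HasBoundedSobolevNormsOn (Icc δ T) (timeDerivWithin (Ioc 0 T) v))
    {δ : ℝ} (hδ : 0 < δ) (hδT : δ < T) :
    ContinuousOn (fun t => ∫ x, frobeniusNormSq (fderiv ℝ (curl (v t)) x)) (Icc δ T) := by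
  -- the shifted field on `[0, T − δ]`
  have hTδ : 0 < T - δ := sub_pos.2 hδT
  have hsub : Icc δ T ⊆ Ioc 0 T := fun t ht => ⟨hδ.trans_le ht.1, ht.2⟩
  have hclI : IsClassicalNSSolutionOn (Icc δ T) ν 0 v q := hcl.mono hsub (uniqueDiffOn_Icc hδT)
  have hsh := hclI.comp_add_right δ
  have hpre : (fun t => t + δ) ⁻¹' Icc δ T = Icc 0 (T - δ) := by
    ext t; simp only [mem_preimage, mem_Icc]; constructor <;> intro h <;> constructor <;> linarith [h.1, h.2]
  rw [hpre] at hsh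
  have hu : IsSmoothSpaceTimeOn (Icc 0 (T - δ)) (fun t => v (t + δ)) := hsh.smooth_velocity
  have hB' : HasBoundedSobolevNormsOn (Icc 0 (T - δ)) (fun t => v (t + δ)) :=
    HasBoundedSobolevNormsOn.comp_add_right δ ((hB δ hδ hδT.le).mono (Icc_subset_Icc (by linarith) (by linarith)))
  -- the time derivative of the shifted field is the shifted time derivative (within `Icc δ T`, which agrees with `Ioc 0 T`)
  have hderiv_eq : ∀ t ∈ Icc 0 (T - δ), timeDerivWithin (Icc 0 (T - δ)) (fun s => v (s + δ)) t =
      timeDerivWithin (Ioc 0 T) v (t + δ) := by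
    intro t ht
    funext x
    have h1 : timeDerivWithin (Icc 0 (T - δ)) (fun s => v (s + δ)) t x = timeDerivWithin (Icc δ T) v (t + δ) x := by
      rw [← hpre, timeDerivWithin_comp_add_right]
    rw [h1]
    exact hcl.smooth_velocity.timeDerivWithin_eq_of_subset hsub (uniqueDiffOn_Icc hδT) ⟨by linarith [ht.1], by linarith [ht.2]⟩ x
  have hBt' : HasBoundedSobolevNormsOn (Icc 0 (T - δ)) (timeDerivWithin (Icc 0 (T - δ)) (fun s => v (s + δ))) := by
    have h0 : HasBoundedSobolevNormsOn (Icc 0 (T - δ)) (fun t => timeDerivWithin (Ioc 0 T) v (t + δ)) :=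
      HasBoundedSobolevNormsOn.comp_add_right δ ((hBt δ hδ hδT.le).mono (Icc_subset_Icc (by linarith) (by linarith)))
    exact h0.congr hderiv_eq
  have hcont := ReferenceShadowing.continuousOn_palinstrophy_of_hasBoundedSobolevNormsOn hTδ hu hB' hBt'
  -- shift back
  have hcomp : ContinuousOn ((fun t => ∫ x, frobeniusNormSq (fderiv ℝ (curl (v (t + δ))) x)) ∘ fun t => t - δ) (Icc δ T) :=
    hcont.comp (continuous_sub_right δ).continuousOn fun t ht => ⟨by linarith [ht.1], by linarith [ht.2]⟩
  refine hcomp.congr fun t _ => ?_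
  simp only [Function.comp_apply, sub_add_cancel]

end ReferenceFlow

end RigidExit

end Summit.NavierStokesRegularity.NavierStokesRegularity.Theorems

end
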